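import Literature.AlgebraicGeometry.HodgeTheory.HodgeGroupExteriorAction
import HarnessLib

/-!
# The Mumford–Tate group acts on `H•(A(ℂ); ℂ) = ⋀•H¹` through `H¹`; `MT(A)(ℂ)|_{H¹} = ℂˣ · Hg(A)(ℂ)|_{H¹}`; Weil type: `MT|_{H¹} ⊆ ℂˣ · SU_H(ℂ)`

Deligne [Deligne1982HodgeCycles, I §3]: the Mumford–Tate group of `V = H¹(A, ℚ)` is the subgroup of
`GL(V) × 𝔾_m` fixing the rational tensors of type `(0,0)` (definition preceding Prop. 3.4); it acts on every
tensor space `V^{⊗a} ⊗ V^{∨⊗b}`, in particular on `⋀ᵏ V = Hᵏ(A, ℚ)`; Prop. 3.4 / 3.6: `MT` is generated by `Hg` and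
the weight cocharacter. Lange [Lange2023AbelianVarietiesComplex, Rem. 7.2.2 (2)]: «the Mumford-Tate group of X is
by definition the scalar extension `𝔾_m · Hg(X)` … `(𝔾_m · Hg(X))(ℂ) = {α · M | α ∈ ℂ*, M ∈ Hg(X)(ℂ)}`». van Geemen
[vanGeemen1994HodgeAV, 6.5]: «Since `G` acts on `V_ℚ` it also acts on `∧ᵏV_ℚ = Hᵏ(X, ℚ)` for all `k`»; Thm. 6.11:
the special Mumford–Tate group of a general abelian variety of Weil type is `SU_H`.

In the tree `MT(X)(ℂ)` (`HodgeTheory.mumfordTateGroup n X`) is Tannaka-free: the subgroup of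
`∏ₖ GL(Hᵏ(X(ℂ); ℂ))` whose Künneth extension acts on the rational `(p,p)`-classes of all powers through a
character of Tate type, and `MT = w(ℂˣ) · Hg` is the PROVED `mem_powClassSimilitudeGroup_iff_exists_weightCocharacter_mul`.
The file `HodgeGroupExteriorAction` proved van Geemen's 6.5 for `Hg`; this file records the same statements for
`MT` (all `theorem`s, no definition, no named fact):

* §1 (any smooth projective `X`): `MT = w(ℂˣ) · Hg` in the `mumfordTateGroup` spelling; `MT` commutes with `f^*`
  for endomorphisms `f`; `w(c) · g` acts on `H^{2n}` by `c^{2n}` and scales the Poincaré pairing by `c^{2n}`.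
* §2 (abelian varieties): **`m_k(v₁ ∪ ⋯ ∪ v_k) = m₁v₁ ∪ ⋯ ∪ m₁v_k`** for `m ∈ MT(A)(ℂ)`
  (`mumfordTateGroup_apply_cupPowOne`), multiplicativity, the exterior-power form, `m` is determined by `m₁`,
  `det m₁ = c^{2 dim A}` for `m = w(c) · g`, `m_{2 dim A} = det(m₁)`, and the multiplier relation
  `m|_{Bᵖ ⊗ ℂ} = μᵖ`, `det m₁ = μ^{dim A}`.
* §3 (`H¹` level): **`MT(X)(ℂ)|_{H¹} = ℂˣ · Hg(X)(ℂ)|_{H¹}`** (`mem_map_mumfordTateGroup_one_iff`); `MT(A)|_{H¹}`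
  commutes with `End(A)`.
* §4 (Weil type, `K = ℚ(√-d)`): `MT(A)(ℂ)|_{H¹} ⊆ ℂˣ · SU_H(ℂ)` for EVERY polarized abelian variety of Weil type
  (van Geemen's first step of 6.11 for `MT`), with equality `MT(A)(ℂ)|_{H¹} = ℂˣ · SU_H(ℂ)` for the general member
  (`HasHodgeGroupSU`) — the top row `SU(φ) ↪ MT(A)` of Milne's diagram [Milne2025AbelianMotivesCharP, Ex. 1.17].

## References

* [Deligne1982HodgeCycles] P. Deligne (notes by J. S. Milne), *Hodge cycles on abelian varieties*, LNM 900 (1982),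
  I §3 (definition preceding Prop. 3.4, Prop. 3.4, 3.6).
* [Lange2023AbelianVarietiesComplex] H. Lange, *Abelian Varieties over the Complex Numbers* (2023), Rem. 7.2.2 (2).
* [vanGeemen1994HodgeAV] B. van Geemen, *An introduction to the Hodge conjecture for abelian varieties*, LNM 1594
  (1994), 6.4, 6.5, 6.9, Lemma 6.10, Thm. 6.11.
* [Milne2025AbelianMotivesCharP] J. S. Milne, *Abelian motives in characteristic p*, arXiv:2508.09972, §1.5 Ex. 1.17.
-/

open CategoryTheory
open Literature.AlgebraicTopology.SingularHomology
open Literature.AlgebraicGeometry.Motives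

namespace Literature.AlgebraicGeometry.HodgeTheory

/-! ### §1 `MT = w(ℂˣ) · Hg` and its consequences on any smooth projective `X` -/

section Generic

variable {n : ℕ} {X : SchemeOver ℂ} {g m : ∀ k : ℕ, complexBetti X k ≃ₗ[ℂ] complexBetti X k}

/-- **`MT(X)(ℂ) = w(ℂˣ) · Hg(X)(ℂ)`** in the `mumfordTateGroup` / `hodgeGroup` spelling: `m ∈ MT(X)(ℂ)` iff
`m = w(c) · g` with `c ∈ ℂˣ` and `g ∈ Hg(X)(ℂ)` (Deligne I 3.4/3.6; Lange Rem. 7.2.2 (2)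
«`(𝔾_m · Hg(X))(ℂ) = {α · M | α ∈ ℂ*, M ∈ Hg(X)(ℂ)}`»; the tree's
`mem_powClassSimilitudeGroup_iff_exists_weightCocharacter_mul`). [cite: Deligne1982HodgeCycles, I Prop. 3.4 and 3.6]
[cite: Lange2023AbelianVarietiesComplex, Rem. 7.2.2 (2)] -/
theorem mem_mumfordTateGroup_iff_exists_weightCocharacter_mul :
    m ∈ mumfordTateGroup n X ↔
      ∃ (c : ℂˣ) (g : ∀ k : ℕ, complexBetti X k ≃ₗ[ℂ] complexBetti X k),
        g ∈ hodgeGroup n X ∧ m = weightCocharacter X c * g :=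
  mem_powClassSimilitudeGroup_iff_exists_weightCocharacter_mul

/-- `w(c) · g ∈ MT(X)(ℂ)` for `g ∈ Hg(X)(ℂ)`. [cite: Lange2023AbelianVarietiesComplex, Rem. 7.2.2 (2)] -/
theorem weightCocharacter_mul_mem_mumfordTateGroup (c : ℂˣ) (hg : g ∈ hodgeGroup n X) :
    weightCocharacter X c * g ∈ mumfordTateGroup n X :=
  (mumfordTateGroup n X).mul_mem (weightCocharacter_mem_mumfordTateGroup c) (hodgeGroup_le_mumfordTateGroup hg)

/-- The degree-one component of `w(c) · g` is `c · g₁` (`w(c)` is `c` on `H¹`; Lange: «`{α · M | α ∈ ℂ*, M ∈ Hg(X)(ℂ)}`»).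
[cite: Lange2023AbelianVarietiesComplex, Rem. 7.2.2 (2)] [cite: Andre1996Motifs, §4.6 Définition (p. 24)] -/
theorem weightCocharacter_mul_apply_one (c : ℂˣ) (g : ∀ k : ℕ, complexBetti X k ≃ₗ[ℂ] complexBetti X k) :
    (weightCocharacter X c * g) 1 = LinearEquiv.smulOfUnit c * g 1 := by
  change weightCocharacter X c 1 * g 1 = _
  rw [show weightCocharacter X c 1 = LinearEquiv.smulOfUnit c from by
    change LinearEquiv.smulOfUnit (c ^ 1) = _
    rw [pow_one]]

/-- **The Mumford–Tate group commutes with pull-back along endomorphisms of the variety** (Deligne I §3: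
morphisms of Hodge structures are `MT`-equivariant; the tree's `hodgeGroup_apply_map` for the `Hg`-factor, the
weight cocharacter being scalar in each degree). [cite: Deligne1982HodgeCycles, I §3 Prop. 3.4 and the definition preceding it] -/
theorem mumfordTateGroup_apply_map (hX : IsSmoothProjective n X) (hm : m ∈ mumfordTateGroup n X) (f : X ⟶ X)
    (k : ℕ) (y : complexBetti X k) : m k (complexBetti.map f k y) = complexBetti.map f k (m k y) := by
  obtain ⟨c, g, hg, rfl⟩ := mem_mumfordTateGroup_iff_exists_weightCocharacter_mul.1 hm
  simp only [Pi.mul_apply, LinearEquiv.mul_apply, weightCocharacter_apply, map_smul]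
  rw [hodgeGroup_apply_map hX hg f k y]

/-- `w(c) · g`, `g ∈ Hg(X)(ℂ)`, acts on the top cohomology `H^{2n}(X(ℂ); ℂ)` by `c^{2n}` (`Hg` acts trivially
there, `hodgeGroup_apply_top`). [cite: vanGeemen1994HodgeAV, 6.4–6.5] [cite: Deligne1982HodgeCycles, I Prop. 3.4] -/
theorem weightCocharacter_mul_apply_top (hX : IsSmoothProjective n X) (hg : g ∈ hodgeGroup n X) (c : ℂˣ)
    (z : complexBetti X (2 * n)) : (weightCocharacter X c * g) (2 * n) z = ((c : ℂ) ^ (2 * n)) • z := by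
  simp only [Pi.mul_apply, LinearEquiv.mul_apply, weightCocharacter_apply]
  rw [hodgeGroup_apply_top hX hg z]

/-- **`MT(X)(ℂ)` acts on `H^{2n}(X(ℂ); ℂ)` through a character**: `m = c^{2n}` there for some `c ∈ ℂˣ`.
[cite: Deligne1982HodgeCycles, I Prop. 3.4] [cite: vanGeemen1994HodgeAV, 6.4–6.5] -/
theorem exists_mumfordTateGroup_apply_top_eq_smul (hX : IsSmoothProjective n X) (hm : m ∈ mumfordTateGroup n X) :
    ∃ c : ℂˣ, ∀ z : complexBetti X (2 * n), m (2 * n) z = ((c : ℂ) ^ (2 * n)) • z := by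
  obtain ⟨c, g, hg, rfl⟩ := mem_mumfordTateGroup_iff_exists_weightCocharacter_mul.1 hm
  exact ⟨c, weightCocharacter_mul_apply_top hX hg c⟩

/-- `w(c) · g`, `g ∈ Hg(X)(ℂ)`, scales the Poincaré pairing `⟨x ∪ y, [X(ℂ)]⟩` by `c^{2n}` (`Hg ⊂ Sp`, van Geemen
6.5, the tree's `hodgeGroup_cupPairing`). [cite: vanGeemen1994HodgeAV, 6.5] [cite: Deligne1982HodgeCycles, I Prop. 3.4] -/
theorem weightCocharacter_mul_cupPairing (hX : IsSmoothProjective n X) (hg : g ∈ hodgeGroup n X) (c : ℂˣ)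
    (μ : OrientationFamily) {k d : ℕ} (hkd : k + d = 2 * n) (x : complexBetti X k) (y : complexBetti X d) :
    cupPairing (μ hX) hkd ((weightCocharacter X c * g) k x) ((weightCocharacter X c * g) d y) =
      ((c : ℂ) ^ (2 * n)) • cupPairing (μ hX) hkd x y := by
  simp only [Pi.mul_apply, LinearEquiv.mul_apply, weightCocharacter_apply, map_smul, LinearMap.smul_apply]
  rw [hodgeGroup_cupPairing hX hg μ hkd x y, smul_smul, ← pow_add, add_comm, hkd]

/-- **`MT(X)(ℂ)` preserves the Poincaré pairing up to a character**: `⟨m x ∪ m y⟩ = c^{2n} ⟨x ∪ y⟩`.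
[cite: vanGeemen1994HodgeAV, 6.5] [cite: Deligne1982HodgeCycles, I Prop. 3.4] -/
theorem exists_mumfordTateGroup_cupPairing_eq_smul (hX : IsSmoothProjective n X) (hm : m ∈ mumfordTateGroup n X)
    (μ : OrientationFamily) :
    ∃ c : ℂˣ, ∀ {k d : ℕ} (hkd : k + d = 2 * n) (x : complexBetti X k) (y : complexBetti X d),
      cupPairing (μ hX) hkd (m k x) (m d y) = ((c : ℂ) ^ (2 * n)) • cupPairing (μ hX) hkd x y := by
  obtain ⟨c, g, hg, rfl⟩ := mem_mumfordTateGroup_iff_exists_weightCocharacter_mul.1 hm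
  exact ⟨c, fun hkd x y ↦ weightCocharacter_mul_cupPairing hX hg c μ hkd x y⟩

/-! ### §3 (generic part) `MT(X)(ℂ)|_{H¹} = ℂˣ · Hg(X)(ℂ)|_{H¹}` -/

/-- **`MT(X)(ℂ)|_{H¹} = ℂˣ · Hg(X)(ℂ)|_{H¹}`**: an automorphism `u` of `H¹(X(ℂ); ℂ)` is the degree-one component of
an element of the Mumford–Tate group iff `u = c · u'` with `c ∈ ℂˣ` and `u' ∈ Hg(X)(ℂ)|_{H¹}` (the tree's
`VanGeemen1994.hodgeGroupOne`). [cite: Lange2023AbelianVarietiesComplex, Rem. 7.2.2 (2)] [cite: Deligne1982HodgeCycles, I Prop. 3.4 and 3.6] -/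
theorem mem_map_mumfordTateGroup_one_iff {u : complexBetti X 1 ≃ₗ[ℂ] complexBetti X 1} :
    u ∈ (mumfordTateGroup n X).map (Pi.evalMonoidHom (fun k : ℕ ↦ complexBetti X k ≃ₗ[ℂ] complexBetti X k) 1) ↔
      ∃ c : ℂˣ, ∃ u' ∈ VanGeemen1994.hodgeGroupOne n X, u = LinearEquiv.smulOfUnit c * u' := by
  constructor
  · rintro ⟨m, hm, rfl⟩
    obtain ⟨c, g, hg, rfl⟩ := mem_mumfordTateGroup_iff_exists_weightCocharacter_mul.1 hm
    exact ⟨c, g 1, VanGeemen1994.mem_hodgeGroupOne_iff.2 ⟨g, hg, rfl⟩, weightCocharacter_mul_apply_one c g⟩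
  · rintro ⟨c, u', hu', rfl⟩
    obtain ⟨g, hg, rfl⟩ := VanGeemen1994.mem_hodgeGroupOne_iff.1 hu'
    exact ⟨weightCocharacter X c * g, weightCocharacter_mul_mem_mumfordTateGroup c hg,
      weightCocharacter_mul_apply_one c g⟩

/-- `Hg(X)(ℂ)|_{H¹} ≤ MT(X)(ℂ)|_{H¹}`. [cite: Deligne1982HodgeCycles, I Prop. 3.4] -/
theorem hodgeGroupOne_le_map_mumfordTateGroup :
    VanGeemen1994.hodgeGroupOne n X ≤
      (mumfordTateGroup n X).map (Pi.evalMonoidHom (fun k : ℕ ↦ complexBetti X k ≃ₗ[ℂ] complexBetti X k) 1) :=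
  Subgroup.map_mono hodgeGroup_le_mumfordTateGroup

/-- The scalars `c · 1` lie in `MT(X)(ℂ)|_{H¹}` (the weight cocharacter). [cite: Deligne1982HodgeCycles, I Prop. 3.4] -/
theorem smulOfUnit_mem_map_mumfordTateGroup (c : ℂˣ) :
    LinearEquiv.smulOfUnit c ∈
      (mumfordTateGroup n X).map (Pi.evalMonoidHom (fun k : ℕ ↦ complexBetti X k ≃ₗ[ℂ] complexBetti X k) 1) :=
  mem_map_mumfordTateGroup_one_iff.2 ⟨c, 1, one_mem _, (mul_one _).symm⟩

end Generic

/-! ### §2 Abelian varieties: `MT(A)(ℂ)` acts on `Hᵏ(A(ℂ); ℂ) = ⋀ᵏH¹` through `⋀ᵏ` of its action on `H¹` -/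

section Abelian

variable {A : AbelianVariety ℂ} {gA mA mA' : ∀ k : ℕ, complexBetti A.X k ≃ₗ[ℂ] complexBetti A.X k}

/-- `w(c) · g`, `g ∈ Hg(A)(ℂ)`, acts on `v₁ ∪ ⋯ ∪ v_k` through its degree-one component (van Geemen 6.5 for `g`,
multilinearity of the iterated cup product for the scalar `c` on each factor). [cite: vanGeemen1994HodgeAV, 6.5]
[cite: Deligne1982HodgeCycles, I §3 (definition preceding Prop. 3.4)] -/
theorem weightCocharacter_mul_apply_cupPowOne (hg : gA ∈ hodgeGroup A.dim A.X) (c : ℂˣ) (k : ℕ)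
    (v : Fin k → complexBetti A.X 1) :
    (weightCocharacter A.X c * gA) k (cupPowOne ℂ (ComplexPoints A.X) k v) =
      cupPowOne ℂ (ComplexPoints A.X) k (fun j ↦ (weightCocharacter A.X c * gA) 1 (v j)) := by
  simp only [Pi.mul_apply, LinearEquiv.mul_apply, weightCocharacter_apply, pow_one]
  rw [hodgeGroup_apply_cupPowOne hg, MultilinearMap.map_smul_univ, Finset.prod_const, Finset.card_univ,
    Fintype.card_fin]

/-- **Deligne I §3 / van Geemen 6.5 for the Mumford–Tate group, on the tree's carriers: `MT(A)(ℂ)` acts on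
`Hᵏ(A(ℂ); ℂ) = ⋀ᵏH¹` through the `k`-th exterior power of its action on `H¹`.** For `m ∈ mumfordTateGroup A.dim A.X`
and `v₁, …, v_k ∈ H¹(A(ℂ); ℂ)`: `m_k(v₁ ∪ ⋯ ∪ v_k) = m₁v₁ ∪ ⋯ ∪ m₁v_k` (`m = w(c) · g` with `g ∈ Hg(A)(ℂ)`, for which
this is `hodgeGroup_apply_cupPowOne`). [cite: Deligne1982HodgeCycles, I §3 (definition preceding Prop. 3.4) and Prop. 3.4]
[cite: vanGeemen1994HodgeAV, 6.4–6.5] [cite: Lange2023AbelianVarietiesComplex, Rem. 7.2.2 (2)] -/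
theorem mumfordTateGroup_apply_cupPowOne (hm : mA ∈ mumfordTateGroup A.dim A.X) (k : ℕ)
    (v : Fin k → complexBetti A.X 1) :
    mA k (cupPowOne ℂ (ComplexPoints A.X) k v) = cupPowOne ℂ (ComplexPoints A.X) k (fun j ↦ mA 1 (v j)) := by
  obtain ⟨c, g, hg, rfl⟩ := mem_mumfordTateGroup_iff_exists_weightCocharacter_mul.1 hm
  exact weightCocharacter_mul_apply_cupPowOne hg c k v

/-- **`MT(A)(ℂ)` acts multiplicatively on `H•(A(ℂ); ℂ)`**: `m(x ∪ y) = m x ∪ m y`.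
[cite: Deligne1982HodgeCycles, I §3 (definition preceding Prop. 3.4)] [cite: vanGeemen1994HodgeAV, 6.5] -/
theorem mumfordTateGroup_map_cupProduct (hm : mA ∈ mumfordTateGroup A.dim A.X) {i j k : ℕ} (h : i + j = k)
    (x : complexBetti A.X i) (y : complexBetti A.X j) :
    mA k (cupProduct h x y) = cupProduct h (mA i x) (mA j y) := by
  obtain ⟨c, g, hg, rfl⟩ := mem_mumfordTateGroup_iff_exists_weightCocharacter_mul.1 hm
  simp only [Pi.mul_apply, LinearEquiv.mul_apply, weightCocharacter_apply, map_smul, LinearMap.smul_apply]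
  rw [hodgeGroup_map_cupProduct hg h x y, smul_smul, ← pow_add, add_comm, h]

/-- On the exterior power: `m_k ∘ (∧ᵏH¹ → Hᵏ) = (∧ᵏH¹ → Hᵏ) ∘ ∧ᵏ(m₁)` for `m ∈ MT(A)(ℂ)`.
[cite: Deligne1982HodgeCycles, I §3 (definition preceding Prop. 3.4)] [cite: vanGeemen1994HodgeAV, 6.5] -/
theorem mumfordTateGroup_apply_wedgeToCup (hm : mA ∈ mumfordTateGroup A.dim A.X) (k : ℕ)
    (ω : ⋀[ℂ]^k (complexBetti A.X 1)) :
    mA k (wedgeToCup ℂ (ComplexPoints A.X) k ω) =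
      wedgeToCup ℂ (ComplexPoints A.X) k
        (exteriorPower.map k (mA 1 : complexBetti A.X 1 →ₗ[ℂ] complexBetti A.X 1) ω) := by
  have key : (mA k : complexBetti A.X k →ₗ[ℂ] complexBetti A.X k) ∘ₗ wedgeToCup ℂ (ComplexPoints A.X) k =
      wedgeToCup ℂ (ComplexPoints A.X) k ∘ₗ
        exteriorPower.map k (mA 1 : complexBetti A.X 1 →ₗ[ℂ] complexBetti A.X 1) := by
    refine LinearMap.ext_on_range (exteriorPower.ιMulti_span ℂ k (complexBetti A.X 1)) fun v ↦ ?_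
    rw [LinearMap.comp_apply, LinearMap.comp_apply, LinearEquiv.coe_coe, wedgeToCup_ιMulti,
      exteriorPower.map_apply_ιMulti, wedgeToCup_ιMulti, mumfordTateGroup_apply_cupPowOne hm]
    rfl
  exact LinearMap.congr_fun key ω

/-- **An element of the Mumford–Tate group of an abelian variety is determined by its action on `H¹`.**
[cite: Deligne1982HodgeCycles, I §3 (definition preceding Prop. 3.4)] [cite: vanGeemen1994HodgeAV, 6.4–6.5] -/
theorem mumfordTateGroup_ext_one (hm : mA ∈ mumfordTateGroup A.dim A.X) (hm' : mA' ∈ mumfordTateGroup A.dim A.X)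
    (h1 : mA 1 = mA' 1) : mA = mA' := by
  funext k
  have hspan := (abelianVarietyCohomologyExteriorH1_holds.hasExteriorCohomologyH1 A).span_range_cupPowOne k
  refine LinearEquiv.toLinearMap_injective (LinearMap.ext_on_range hspan fun v ↦ ?_)
  rw [LinearEquiv.coe_coe, LinearEquiv.coe_coe, mumfordTateGroup_apply_cupPowOne hm,
    mumfordTateGroup_apply_cupPowOne hm', h1]

/-- **`det(w(c) · g)₁ = c^{2 dim A}`** for `g ∈ Hg(A)(ℂ)` (`det g₁ = 1`, van Geemen 6.4 `G ⊂ SL(V)`, the tree's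
`hodgeGroupOne_det_eq_one`; `dim H¹ = 2 dim A`). [cite: vanGeemen1994HodgeAV, 6.4] [cite: Deligne1982HodgeCycles, I Prop. 3.4] -/
theorem det_weightCocharacter_mul_apply_one (hg : gA ∈ hodgeGroup A.dim A.X) (c : ℂˣ) :
    LinearMap.det ((weightCocharacter A.X c * gA) 1 : complexBetti A.X 1 →ₗ[ℂ] complexBetti A.X 1) =
      (c : ℂ) ^ (2 * A.dim) := by
  have e : ((weightCocharacter A.X c * gA) 1 : complexBetti A.X 1 →ₗ[ℂ] complexBetti A.X 1) =
      (c : ℂ) • (gA 1 : complexBetti A.X 1 →ₗ[ℂ] complexBetti A.X 1) := by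
    ext x
    simp only [Pi.mul_apply, LinearEquiv.coe_coe, LinearEquiv.mul_apply, weightCocharacter_apply, pow_one,
      LinearMap.smul_apply]
  haveI := abelianVarietyCohomologyExteriorH1_holds.finite_one A
  rw [e, LinearMap.det_smul, abelianVarietyCohomologyExteriorH1_holds.finrank_one A,
    hodgeGroupOne_det_eq_one (VanGeemen1994.mem_hodgeGroupOne_iff.2 ⟨gA, hg, rfl⟩), mul_one]

/-- **On the top cohomology `H^{2 dim A}(A(ℂ); ℂ) = ⋀^{2 dim A} H¹`, `m ∈ MT(A)(ℂ)` acts by `det m₁`.**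
[cite: vanGeemen1994HodgeAV, 6.4–6.5] [cite: Deligne1982HodgeCycles, I Prop. 3.4] -/
theorem mumfordTateGroup_apply_top_eq_det_smul (hm : mA ∈ mumfordTateGroup A.dim A.X)
    (z : complexBetti A.X (2 * A.dim)) :
    mA (2 * A.dim) z = LinearMap.det (mA 1 : complexBetti A.X 1 →ₗ[ℂ] complexBetti A.X 1) • z := by
  obtain ⟨c, g, hg, rfl⟩ := mem_mumfordTateGroup_iff_exists_weightCocharacter_mul.1 hm
  rw [det_weightCocharacter_mul_apply_one hg c,
    weightCocharacter_mul_apply_top AbelianVariety.isSmoothProjective_holds hg c z]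

/-- **The multiplier of `m ∈ MT(A)(ℂ)`**: there is `μ ∈ ℂˣ` with `m = μᵖ` on `Bᵖ(A) ⊗ ℂ` for every `p` (the action
of `MT ≤ GL(V) × 𝔾_m` on the Hodge classes through the Tate character) and `det m₁ = μ^{dim A}` (for
`m = w(c) · g`: `μ = c²`). [cite: Deligne1982HodgeCycles, I §3 (definition preceding Prop. 3.4) and Prop. 3.4]
[cite: vanGeemen1994HodgeAV, 6.4] -/
theorem exists_mumfordTateGroup_multiplier (hm : mA ∈ mumfordTateGroup A.dim A.X) :
    ∃ μ : ℂˣ, (∀ (p : ℕ), ∀ x ∈ VanGeemen1994.hodgeClassSpan A.dim A.X p, mA (2 * p) x = ((μ : ℂ) ^ p) • x) ∧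
      LinearMap.det (mA 1 : complexBetti A.X 1 →ₗ[ℂ] complexBetti A.X 1) = (μ : ℂ) ^ A.dim := by
  obtain ⟨c, g, hg, rfl⟩ := mem_mumfordTateGroup_iff_exists_weightCocharacter_mul.1 hm
  refine ⟨c ^ 2, fun p x hx ↦ ?_, ?_⟩
  · simp only [Pi.mul_apply, LinearEquiv.mul_apply, weightCocharacter_apply]
    rw [VanGeemen1994.apply_eq_self_of_mem_hodgeClassSpan hg hx, Units.val_pow_eq_pow_val, ← pow_mul]
  · rw [det_weightCocharacter_mul_apply_one hg c, Units.val_pow_eq_pow_val, ← pow_mul]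

/-- **`MT(A)(ℂ)|_{H¹}` commutes with `End(A)` acting on `H¹`** (`φ^*` is `MT`-equivariant).
[cite: Deligne1982HodgeCycles, I §3 Prop. 3.4] [cite: vanGeemen1994HodgeAV, 6.9 and proof of Thm. 6.11] -/
theorem mumfordTateGroup_apply_one_comm_pullbackOne (hm : mA ∈ mumfordTateGroup A.dim A.X) (φ : A ⟶ A)
    (x : complexBetti A.X 1) :
    mA 1 (VanGeemen1994.pullbackOne A φ x) = VanGeemen1994.pullbackOne A φ (mA 1 x) :=
  mumfordTateGroup_apply_map AbelianVariety.isSmoothProjective_holds hm φ.hom.hom.hom 1 x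

end Abelian

/-! ### §4 Weil type (`K = ℚ(√-d)`): `MT(A)(ℂ)|_{H¹} ⊆ ℂˣ · SU_H(ℂ)`, with equality for the general member -/

section WeilType

variable {A : AbelianVariety ℂ} {mA : ∀ k : ℕ, complexBetti A.X k ≃ₗ[ℂ] complexBetti A.X k}

/-- **`MT(A)(ℂ)|_{H¹} ⊆ ℂˣ · SU_H(ℂ)` for EVERY polarized abelian variety of Weil type** (`dim A = 2n`,
`φ ≫ φ = -d`, `n, d ≥ 1`, the Weil plane of Hodge type `(n,n)`, `h ∈ B¹(A) ⊗ ℂ`): the degree-one component of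
`m ∈ MT(A)(ℂ)` is `c · u` with `c ∈ ℂˣ` and `u ∈ SU_H(ℂ)` (van Geemen's first step of Thm. 6.11, `Hg ⊆ SU_H`, the
tree's `hodgeGroupOne_le_weilSpecialUnitaryGroup`, and `MT = 𝔾_m · Hg`). [cite: vanGeemen1994HodgeAV, proof of Thm. 6.11 (first step), 6.9–6.10]
[cite: Lange2023AbelianVarietiesComplex, Rem. 7.2.2 (2)] -/
theorem exists_eq_smulOfUnit_mul_of_mem_mumfordTateGroup_of_weilType {n d : ℕ} (hn : 0 < n) (hd : 0 < d)
    (hA : A.dim = 2 * n) {φ : A ⟶ A} (hφ : φ ≫ φ = -(d • 𝟙 A))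
    (hW : ∀ c ∈ weilClassesOf A φ n d, IsOfHodgeType (2 * n) A.X (2 * n) n n c)
    {h : complexBetti A.X 2} (hh : h ∈ VanGeemen1994.hodgeClassSpan A.dim A.X 1)
    (hm : mA ∈ mumfordTateGroup A.dim A.X) :
    ∃ c : ℂˣ, ∃ u ∈ VanGeemen1994.weilSpecialUnitaryGroup A φ n d h, mA 1 = LinearEquiv.smulOfUnit c * u := by
  obtain ⟨c, u', hu', e⟩ := mem_map_mumfordTateGroup_one_iff.1 ⟨mA, hm, rfl⟩
  exact ⟨c, u', hodgeGroupOne_le_weilSpecialUnitaryGroup hn hd hA hφ hW hh hu', e⟩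

/-- **`MT(A)(ℂ)|_{H¹} = ℂˣ · SU_H(ℂ)` FOR THE GENERAL ABELIAN VARIETY OF WEIL TYPE** (`Hg = SU_H`, the tree's
`HasHodgeGroupSU`; van Geemen Thm. 6.11, Milne's top row `SU(φ) ↪ MT(A)`): `u` is the degree-one component of an
element of `MT(A)(ℂ)` iff `u = c · u'` with `c ∈ ℂˣ`, `u' ∈ SU_H(ℂ)`. [cite: vanGeemen1994HodgeAV, Thm. 6.11]
[cite: Milne2025AbelianMotivesCharP, §1.5 Example 1.17] [cite: Lange2023AbelianVarietiesComplex, Rem. 7.2.2 (2)] -/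
theorem mem_map_mumfordTateGroup_one_iff_of_hasHodgeGroupSU {n d : ℕ} {φ : A ⟶ A} {h : complexBetti A.X 2}
    (hSU : VanGeemen1994.HasHodgeGroupSU A φ n d h) {u : complexBetti A.X 1 ≃ₗ[ℂ] complexBetti A.X 1} :
    u ∈ (mumfordTateGroup A.dim A.X).map
        (Pi.evalMonoidHom (fun k : ℕ ↦ complexBetti A.X k ≃ₗ[ℂ] complexBetti A.X k) 1) ↔
      ∃ c : ℂˣ, ∃ u' ∈ VanGeemen1994.weilSpecialUnitaryGroup A φ n d h, u = LinearEquiv.smulOfUnit c * u' := by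
  rw [mem_map_mumfordTateGroup_one_iff, VanGeemen1994.hasHodgeGroupSU_iff.1 hSU]

/-- For the general member, `SU_H(ℂ) ≤ MT(A)(ℂ)|_{H¹}`. [cite: vanGeemen1994HodgeAV, Thm. 6.11]
[cite: Milne2025AbelianMotivesCharP, §1.5 Example 1.17] -/
theorem weilSpecialUnitaryGroup_le_map_mumfordTateGroup_of_hasHodgeGroupSU {n d : ℕ} {φ : A ⟶ A}
    {h : complexBetti A.X 2} (hSU : VanGeemen1994.HasHodgeGroupSU A φ n d h) :
    VanGeemen1994.weilSpecialUnitaryGroup A φ n d h ≤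
      (mumfordTateGroup A.dim A.X).map
        (Pi.evalMonoidHom (fun k : ℕ ↦ complexBetti A.X k ≃ₗ[ℂ] complexBetti A.X k) 1) := by
  rw [← VanGeemen1994.hasHodgeGroupSU_iff.1 hSU]
  exact hodgeGroupOne_le_map_mumfordTateGroup

end WeilType

end Literature.AlgebraicGeometry.HodgeTheory
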